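import Summits.CriticalPhenomena.PercolationContinuityZ3.Theses.PercLowPointHalfSpace
import Summits.CriticalPhenomena.PercolationContinuityZ3.Theorems.BoundaryTwoArmDecay.Negative.LoadBearing
import Literature.Probability.Percolation.HalfSpacePinnedPairs
import Literature.Probability.Percolation.HalfSpaceStar
import Literature.Probability.Percolation.SitePaths

/-!
# Crux `PercLowPointHalfSpace.BoundaryTwoArmDecay` (stmt-CriticalPhenomena-0911), line
# `merge-forest-level-bridges` — stub `stub_reduction`

Helper file for the crux skeleton `Cruxes/BoundaryTwoArmDecay/Lines/merge_forest_level_bridges.lean`.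
Proves EXACTLY the registered stub signature `stub_reduction` (the first step of the composition
`BoundaryTwoArmDecay_of`); lands with `--supports stmt-CriticalPhenomena-0911`.

## The statement

With `P = P_{p_c(ℤ³)}`, `ℍ = {z | 0 ≤ z 0}`, `e = (0,1,0) = Pi.single 1 1`, `f = {0, 0 + e}` the floor
edge between the two roots, `E r = {arm_ℍ(0,r) ∧ arm_ℍ(e,r) ∧ 0 ↮_ℍ e}` (`Negative.E`),
`H₁ = {z | 1 ≤ z 0}`, for every `r ≥ 1` and every `h : ℕ`:

  `p_c · P(E r) ≤ P(LB♭(r,h) at 0) + P(Thin(r,h) at 0) + P(Thin(r,h) at e)`,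

where `LB♭(r,h)` (at the root `0`) is the event `{f open} ∩ {ω ∖ f ∉ (0 ↔ e in ℍ)} ∩ ⋂_{x ∈ {0, e}}
{∃ u ∈ x + B_r, ω ∖ f ∈ (x ↔ u in ℍ), and the H₁-cluster of u in ω has two vertices v, w with
|v i - w i| ≥ h for some i}` and `Thin(r,h)` at `x` is
`{∃ y at sup-distance ≥ r from x, ω ∈ (x ↔ y inside the slab {0 ≤ z 0 ≤ h})}`.

## The argument

1. *Bridge step.* On `E r` the edge `f` is closed (it would join `0` to `e` inside `ℍ`), so
   `E r ⊆ Ê := {ω | ω ∖ f ∈ E r}` (`E_subset_hat`). The event `Ê` is determined by the edges other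
   than `f` and `{f open}` by `f` alone, so `P({f open} ∩ Ê) = p_c · P(Ê) ≥ p_c · P(E r)`
   (disjoint-support independence `bondPercolation_real_inter_of_disjoint`, one-edge marginal
   `bondPercolation_cylinder`).
2. *Pathwise inclusion* `{f open} ∩ Ê ⊆ LB♭ ∪ Thin₀ ∪ Thin_e` for configurations on lattice edges
   (`mem_cover`), by the walk surgery `side` applied to each root `x ∈ {0, e}` and `ω' = ω ∖ f`: the
   `ω'`-open path in `ℍ` from `x` to sup-distance `≥ r` has a FIRST EXIT `a → u` from the box
   `x + B_{r-1}` (`PathIn.exit_or`); `u` lies in `x + B_r` at sup-distance exactly `r` from `x`, and the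
   segment `x → u` stays in `ℍ ∩ (x + B_r)`. Either this segment stays in the slab `{z 0 ≤ h}` — then it
   is an `ω`-open path inside `{0 ≤ z 0 ≤ h}` and `ω ∈ Thin(r,h)` at `x` — or it has a first vertex `u'`
   above height `h` (`PathIn.exit_or` again); then `u' ∈ x + B_r`, `ω' ∈ (x ↔ u' in ℍ)`, and the LAST
   VISIT of the segment `x → u'` to the floor (`PathIn.last_exit_or`) is followed by a step to a vertex
   `b` at height `1` and a path inside `H₁` from `b` to `u'`: the `H₁`-cluster of `u'` contains `u'` and
   `b` with `u' 0 - b 0 ≥ h`.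
3. Sub-additivity (`measureReal_union_le`) finishes.

Tree API used: `PathIn` and its surgery lemmas (`SitePaths.lean`), `DCT16.pathIn_of_mem_openConnIn`,
`DCT16.mem_openConnIn_of_pathIn`, `DCT16.adj_of_openGraph_adj`, `real_mono_of_forall_subset_edgeSet`
(`SharpnessDCTProofs.lean`), `measurableSet_openConnIn_of_countable` (`HalfSpacePinnedPairs.lean`),
`BGN.determinedBy_mem_edge` (`HalfSpaceStar.lean`), `bondPercolation_real_inter_of_disjoint`
(`FiniteEnergy.lean`), `bondPercolation_cylinder`, `determinedBy_iff`, `openGraph_mono`,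
`zdGraph_adj_iff`, `mem_box`, and `Negative.E`, `Negative.adj_zero_e`, `Negative.e_ne_zero`,
`Negative.e_mem_H` (`Negative/LoadBearing.lean`).
-/

noncomputable section

namespace Summit.CriticalPhenomena.PercolationContinuityZ3.Theorems.BoundaryTwoArmDecay

open MeasureTheory
open Literature.Probability.Percolation Literature.Probability.LatticeModels
open Literature.Probability.Percolation.DCT16
open Summit.CriticalPhenomena.PercolationContinuityZ3.Theorems.BoundaryTwoArmDecay.Negative
  (H e μ E adj_zero_e e_ne_zero e_mem_H)

namespace StubReduction

/-! ### Lattice facts -/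

/-- Lattice neighbours differ by at most `1` in every coordinate. -/
theorem abs_sub_le_one_of_adj {a b : Site 3} (hab : (zdGraph 3).Adj a b) (k : Fin 3) :
    |b k - a k| ≤ 1 := by
  obtain ⟨i, hb | ha⟩ := (zdGraph_adj_iff a b).1 hab
  · subst hb
    rw [Pi.add_apply]
    rcases eq_or_ne k i with rfl | hk
    · simp
    · simp [Pi.single_eq_of_ne hk]
  · subst ha
    rw [Pi.add_apply]
    rcases eq_or_ne k i with rfl | hk
    · simp
    · simp [Pi.single_eq_of_ne hk]

/-- `e 0 = 0`: the floor neighbour `e` lies on the floor. -/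
theorem e_apply_zero : (e : Site 3) 0 = 0 := by
  simp [e]

/-- The floor edge `f = {0, 0 + e}` is a lattice edge. -/
theorem floorEdge_mem_edgeSet : s((0 : Site 3), (0 : Site 3) + e) ∈ (zdGraph 3).edgeSet :=
  (SimpleGraph.mem_edgeSet _).2 (by rw [zero_add]; exact adj_zero_e)

/-! ### The walk surgery at one root -/

/-- **One side of the bridge.** Let `ω' ⊆ ω` use lattice edges only, let `x` be a floor root
(`x 0 = 0`, level `t = 0`) and suppose `ω'` joins `x` inside `H_t = ℍ` to a vertex at sup-distance
`≥ r ≥ 1` from `x`. Then either `ω ∈ Thin(r,h)` at `x` (an `ω`-open path inside the slab `{0 ≤ z 0 ≤ h}`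
from `x` to sup-distance `≥ r`), or there is a ♭-witness `u ∈ x + B_r` with `ω' ∈ (x ↔ u in ℍ)` whose
`H_{t+1}`-cluster in `ω` contains two vertices at distance `≥ h` in some coordinate (first exit from
`x + B_{r-1}`, first exit from the slab, last visit to the floor). -/
theorem side {ω ω' : BondConfig (Site 3)} (hsub : ω' ⊆ ω) (hE : ω' ⊆ (zdGraph 3).edgeSet)
    {x : Site 3} (hx : x 0 = 0) {r : ℕ} (hr : 1 ≤ r) (h : ℕ) {t : ℤ} (ht : t = 0)
    (harm : ∃ y : Site 3, (∃ i : Fin 3, (r : ℤ) ≤ |y i - x i|) ∧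
      ω' ∈ openConnIn {z : Site 3 | t ≤ z 0} x y) :
    (∃ y : Site 3, (∃ i : Fin 3, (r : ℤ) ≤ |y i - x i|) ∧
        ω ∈ openConnIn {z : Site 3 | 0 ≤ z 0 ∧ z 0 ≤ h} x y) ∨
      ∃ u : Site 3, u - x ∈ box 3 r ∧ ω' ∈ openConnIn {z : Site 3 | t ≤ z 0} x u ∧
        ∃ v w : Site 3, ω ∈ openConnIn {z : Site 3 | t + 1 ≤ z 0} u v ∧
          ω ∈ openConnIn {z : Site 3 | t + 1 ≤ z 0} u w ∧ ∃ i : Fin 3, (h : ℤ) ≤ |v i - w i| := by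
  subst ht
  obtain ⟨y, ⟨i, hi⟩, hy⟩ := harm
  have hπ : PathIn (openGraph ω') H x y := pathIn_of_mem_openConnIn hy
  -- first exit from the box of radius `r - 1` around `x`
  have hxR : x ∈ {z : Site 3 | ∀ j, |z j - x j| ≤ (r : ℤ) - 1} := by
    intro j
    rw [sub_self, abs_zero]
    omega
  rcases hπ.exit_or hxR with hstay | ⟨a, b, haR, hbR, hbH, hab, hxa⟩
  · exfalso
    have hyR : ∀ j, |y j - x j| ≤ (r : ℤ) - 1 := hstay.right_mem.1
    linarith [hyR i]
  have haR' : ∀ j, |a j - x j| ≤ (r : ℤ) - 1 := haR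
  have hbR' : ¬ ∀ j, |b j - x j| ≤ (r : ℤ) - 1 := hbR
  -- the exit vertex `b` lies in `x + B_r`, at sup-distance exactly `r`
  have hbbox : ∀ j, |b j - x j| ≤ (r : ℤ) := fun j => by
    have h1 := abs_sub_le_one_of_adj (adj_of_openGraph_adj hE hab) j
    have h2 := haR' j
    have h3 := abs_sub_le (b j) (a j) (x j)
    linarith
  obtain ⟨i', hi'⟩ : ∃ i' : Fin 3, (r : ℤ) ≤ |b i' - x i'| := by
    by_contra hcon
    exact hbR' fun j => Int.le_sub_one_iff.2 (not_le.1 fun hj => hcon ⟨j, hj⟩)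
  -- the segment `x → a → b` inside `ℍ ∩ (x + B_r)`
  have hRR' : {z : Site 3 | ∀ j, |z j - x j| ≤ (r : ℤ) - 1} ∩ H ⊆
      {z : Site 3 | ∀ j, |z j - x j| ≤ (r : ℤ)} ∩ H := by
    rintro z ⟨hz1, hz2⟩
    have hz1' : ∀ j, |z j - x j| ≤ (r : ℤ) - 1 := hz1
    exact ⟨fun j => (hz1' j).trans (by linarith), hz2⟩
  have hxb : PathIn (openGraph ω') ({z : Site 3 | ∀ j, |z j - x j| ≤ (r : ℤ)} ∩ H) x b :=
    (hxa.mono hRR').tail hab ⟨hbbox, hbH⟩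
  -- first exit from the slab `{z 0 ≤ h}`
  have hxS : x ∈ {z : Site 3 | z 0 ≤ (h : ℤ)} := by
    show x 0 ≤ (h : ℤ)
    omega
  rcases hxb.exit_or hxS with hstay | ⟨a₂, u, -, huS, huA, hau, hxa₂⟩
  · -- THIN: the whole segment lies in the slab
    left
    refine ⟨b, ⟨i', hi'⟩,
      mem_openConnIn_of_pathIn ((hstay.mono ?_).mono_graph (openGraph_mono hsub))⟩
    rintro z ⟨hz1, -, hz3⟩
    exact ⟨hz3, hz1⟩
  -- FLAT: `u` is the first vertex of the segment above height `h`
  right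
  have huS' : ¬ u 0 ≤ (h : ℤ) := huS
  have hubox : ∀ j, |u j - x j| ≤ (r : ℤ) := huA.1
  have hxu : PathIn (openGraph ω') H x u := (hxa₂.mono fun z hz => hz.2.2).tail hau huA.2
  refine ⟨u, ?_, mem_openConnIn_of_pathIn hxu, ?_⟩
  · rw [mem_box]
    intro j
    have h1 := hubox j
    rw [abs_le] at h1
    simpa only [Pi.sub_apply] using h1
  -- last visit of the segment `x → u` to the floor
  have hxC : x ∈ {z : Site 3 | z 0 ≤ 0} := by
    show x 0 ≤ 0
    omega
  rcases hxu.last_exit_or hxC with huC | ⟨a₃, b₃, ha₃C, ha₃H, hb₃C, hab₃, hb₃u⟩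
  · exfalso
    have huC' : u 0 ≤ 0 := huC
    omega
  have ha₃C' : a₃ 0 ≤ 0 := ha₃C
  have ha₃H' : 0 ≤ a₃ 0 := ha₃H
  have hb₃C' : ¬ b₃ 0 ≤ 0 := hb₃C
  have hb₃1 : b₃ 0 = 1 := by
    have h1 := abs_sub_le_one_of_adj (adj_of_openGraph_adj hE hab₃) 0
    rw [abs_le] at h1
    omega
  have hH1 : H \ {z : Site 3 | z 0 ≤ 0} ⊆ {z : Site 3 | (0 : ℤ) + 1 ≤ z 0} := by
    rintro z ⟨-, hz⟩
    have hz' : ¬ z 0 ≤ 0 := hz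
    show (0 : ℤ) + 1 ≤ z 0
    omega
  have hub₃ : PathIn (openGraph ω) {z : Site 3 | (0 : ℤ) + 1 ≤ z 0} u b₃ :=
    ((hb₃u.mono hH1).mono_graph (openGraph_mono hsub)).symm
  refine ⟨u, b₃, mem_openConnIn_of_pathIn (PathIn.refl hub₃.left_mem),
    mem_openConnIn_of_pathIn hub₃, 0, ?_⟩
  rw [hb₃1, abs_of_nonneg (by omega)]
  omega

/-! ### The pathwise inclusion `{f open} ∩ Ê ⊆ LB♭ ∪ Thin₀ ∪ Thin_e` -/

/-- **Pathwise inclusion** (the two roots). If `ω' ⊆ ω` uses lattice edges and `ω' ∈ E r` (`r ≥ 1`),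
then `ω ∈ Thin(r,h)` at `0`, or `ω ∈ Thin(r,h)` at `e`, or both sides of the floor edge carry a
♭-witness (the last three conjuncts of `LB♭(r,h)` at `0`, with `ω'` for `ω ∖ f`). The level `0` is
spelled `(0 : Site 3) 0` and the second root `0 + e`, verbatim as in the registered statement. -/
theorem mem_cover {r h : ℕ} (hr : 1 ≤ r) {ω ω' : BondConfig (Site 3)} (hsub : ω' ⊆ ω)
    (hω' : ω' ⊆ (zdGraph 3).edgeSet) (hE : ω' ∈ E r) :
    (∃ y : Site 3, (∃ i : Fin 3, (r : ℤ) ≤ |y i - (0 : Site 3) i|) ∧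
        ω ∈ openConnIn {z : Site 3 | 0 ≤ z 0 ∧ z 0 ≤ h} 0 y) ∨
    (∃ y : Site 3, (∃ i : Fin 3, (r : ℤ) ≤ |y i - e i|) ∧
        ω ∈ openConnIn {z : Site 3 | 0 ≤ z 0 ∧ z 0 ≤ h} e y) ∨
    (ω' ∉ openConnIn {z : Site 3 | (0 : Site 3) 0 ≤ z 0} 0 (0 + e) ∧
      (∃ u : Site 3, u - 0 ∈ box 3 r ∧ ω' ∈ openConnIn {z : Site 3 | (0 : Site 3) 0 ≤ z 0} 0 u ∧
        ∃ v w : Site 3, ω ∈ openConnIn {z : Site 3 | (0 : Site 3) 0 + 1 ≤ z 0} u v ∧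
          ω ∈ openConnIn {z : Site 3 | (0 : Site 3) 0 + 1 ≤ z 0} u w ∧
          ∃ i : Fin 3, (h : ℤ) ≤ |v i - w i|) ∧
      (∃ u : Site 3, u - (0 + e) ∈ box 3 r ∧
        ω' ∈ openConnIn {z : Site 3 | (0 : Site 3) 0 ≤ z 0} (0 + e) u ∧
        ∃ v w : Site 3, ω ∈ openConnIn {z : Site 3 | (0 : Site 3) 0 + 1 ≤ z 0} u v ∧
          ω ∈ openConnIn {z : Site 3 | (0 : Site 3) 0 + 1 ≤ z 0} u w ∧
          ∃ i : Fin 3, (h : ℤ) ≤ |v i - w i|)) := by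
  obtain ⟨h01, h02, h03⟩ := hE
  -- the root `0`
  have harm0 : ∃ y : Site 3, (∃ i : Fin 3, (r : ℤ) ≤ |y i - (0 : Site 3) i|) ∧
      ω' ∈ openConnIn {z : Site 3 | (0 : Site 3) 0 ≤ z 0} 0 y := by
    obtain ⟨y, ⟨i, hi⟩, hy⟩ := h01
    exact ⟨y, ⟨i, by simpa using hi⟩, hy⟩
  rcases side (x := 0) (t := (0 : Site 3) 0) hsub hω' rfl hr h rfl harm0 with hthin | hflat0
  · exact Or.inl hthin
  -- the root `e`
  have harmE : ∃ y : Site 3, (∃ i : Fin 3, (r : ℤ) ≤ |y i - e i|) ∧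
      ω' ∈ openConnIn {z : Site 3 | (0 : Site 3) 0 ≤ z 0} e y := h02
  rcases side (x := e) (t := (0 : Site 3) 0) hsub hω' e_apply_zero hr h rfl harmE with
    hthin | ⟨u, hu, hωu, hbig⟩
  · exact Or.inr (Or.inl hthin)
  refine Or.inr (Or.inr ⟨?_, hflat0, u, ?_, ?_, hbig⟩)
  · rw [zero_add]
    exact h03
  · rwa [zero_add]
  · rw [zero_add]
    exact hωu

/-! ### The bridge step: `E r ⊆ Ê`, independence of `f` from `Ê` -/

/-- On `E r` the floor edge `f` is closed (it would join `0` to `e` inside `ℍ`), so `ω ∖ f = ω`. -/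
theorem sdiff_floorEdge_eq_of_mem_E {r : ℕ} {ω : BondConfig (Site 3)} (hω : ω ∈ E r) :
    ω \ {s((0 : Site 3), (0 : Site 3) + e)} = ω := by
  refine Set.sdiff_singleton_eq_self fun hf => hω.2.2 ?_
  have hf' : s((0 : Site 3), e) ∈ ω := by simpa only [zero_add] using hf
  exact mem_openConnIn_of_pathIn
    (PathIn.of_adj (by simp [H]) e_mem_H ((openGraph_adj _ _ _).2 ⟨hf', e_ne_zero.symm⟩))

/-- `E r ⊆ Ê = {ω | ω ∖ f ∈ E r}`. -/
theorem E_subset_hat (r : ℕ) : E r ⊆ {ω | ω \ {s((0 : Site 3), (0 : Site 3) + e)} ∈ E r} :=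
  fun ω hω => by
    show ω \ {s((0 : Site 3), (0 : Site 3) + e)} ∈ E r
    rw [sdiff_floorEdge_eq_of_mem_E hω]
    exact hω

/-- For any event `A` and pair `f`, the event `{ω | ω ∖ f ∈ A}` is determined by the pairs other
than `f`. -/
theorem determinedBy_sdiff_mem {V : Type*} (A : Set (BondConfig V)) (f : Sym2 V) :
    DeterminedBy {ω : BondConfig V | ω \ {f} ∈ A} ({f}ᶜ : Set (Sym2 V)) := by
  rw [determinedBy_iff]
  intro ω ω' hω
  simp only [Set.mem_setOf_eq, Set.sdiff_eq, hω]

/-- A one-arm event `{∃ y, P y ∧ x ↔ y in S}` is measurable (countable union). -/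
theorem measurableSet_arm (P : Site 3 → Prop) (S : Set (Site 3)) (x : Site 3) :
    MeasurableSet {ω : BondConfig (Site 3) | ∃ y : Site 3, P y ∧ ω ∈ openConnIn S x y} := by
  have hU : {ω : BondConfig (Site 3) | ∃ y : Site 3, P y ∧ ω ∈ openConnIn S x y} =
      ⋃ y ∈ {y | P y}, openConnIn S x y := by
    ext ω
    simp
  rw [hU]
  exact MeasurableSet.biUnion (Set.to_countable _) fun y _ =>
    measurableSet_openConnIn_of_countable S x y

/-- The crux event `E r` is measurable. -/
theorem measurableSet_E (r : ℕ) : MeasurableSet (E r) :=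
  (measurableSet_arm _ H 0).inter
    ((measurableSet_arm _ H e).inter (measurableSet_openConnIn_of_countable H 0 e).compl)

/-- Removing a fixed set of pairs is a measurable map of bond configurations. -/
theorem measurable_sdiff_const {V : Type*} (F : Set (Sym2 V)) :
    Measurable fun ω : BondConfig V => ω \ F :=
  measurable_set_iff.2 fun a => (measurable_set_mem a).and measurable_const

/-- **One-edge independence**: for a lattice edge `f` and a measurable event `A`,
`P({f open} ∩ {ω | ω ∖ f ∈ A}) = p_c · P({ω | ω ∖ f ∈ A})` (the two events are determined by the
disjoint sets of pairs `{f}` and `{f}ᶜ`). -/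
theorem real_mem_inter_sdiff_mem {f : Sym2 (Site 3)} (hf : f ∈ (zdGraph 3).edgeSet)
    {A : Set (BondConfig (Site 3))} (hA : MeasurableSet A) :
    μ.real ({ω : BondConfig (Site 3) | f ∈ ω} ∩ {ω | ω \ {f} ∈ A}) =
      (criticalProbI 3 : ℝ) * μ.real {ω : BondConfig (Site 3) | ω \ {f} ∈ A} := by
  rw [bondPercolation_real_inter_of_disjoint (zdGraph 3) (criticalProbI 3) disjoint_compl_right
    (BGN.determinedBy_mem_edge f) (determinedBy_sdiff_mem A f) (measurableSet_mem _)
    (measurable_sdiff_const {f} hA), bondPercolation_cylinder (zdGraph 3) (criticalProbI 3) hf]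

/-- **The bridge step**: `p_c · P(E r) ≤ P({f open} ∩ Ê)` for the floor edge `f = {0, 0 + e}`. -/
theorem mul_real_E_le (r : ℕ) :
    (criticalProbI 3 : ℝ) * μ.real (E r) ≤
      μ.real ({ω : BondConfig (Site 3) | s((0 : Site 3), (0 : Site 3) + e) ∈ ω} ∩
        {ω | ω \ {s((0 : Site 3), (0 : Site 3) + e)} ∈ E r}) := by
  rw [real_mem_inter_sdiff_mem floorEdge_mem_edgeSet (measurableSet_E r)]
  exact mul_le_mul_of_nonneg_left (measureReal_mono (E_subset_hat r)) (criticalProbI 3).2.1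

end StubReduction

open StubReduction in
/-- **Stub `stub_reduction`** (bridge identity + first-exit / last-floor-visit split): at
`p = p_c(ℤ³)`, with `ℍ = {z | 0 ≤ z 0}`, `e = (0,1,0)`, `f = {0, 0 + e}`, for every `r ≥ 1` and every `h`,
`p_c · P(arm_ℍ(0,r), arm_ℍ(e,r), 0 ↮_ℍ e) ≤ P(LB♭(r,h) at 0) + P(Thin(r,h) at 0) + P(Thin(r,h) at e)`:
the bridge step `mul_real_E_le`, the pathwise inclusion `mem_cover` (up to the null set of configurations
using non-lattice pairs, `real_mono_of_forall_subset_edgeSet`) and sub-additivity. -/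
theorem stub_reduction :
    ∀ r h : ℕ, 1 ≤ r →
      (criticalProbI 3 : ℝ) *
          (bondPercolation (zdGraph 3) (criticalProbI 3)).real
            {ω | (∃ y : Site 3, (∃ i : Fin 3, (r : ℤ) ≤ |y i|) ∧
                  ω ∈ openConnIn {x : Site 3 | 0 ≤ x 0} 0 y) ∧
                (∃ y : Site 3, (∃ i : Fin 3, (r : ℤ) ≤ |y i - (Pi.single 1 1 : Site 3) i|) ∧
                  ω ∈ openConnIn {x : Site 3 | 0 ≤ x 0} (Pi.single 1 1 : Site 3) y) ∧
                ω ∉ openConnIn {x : Site 3 | 0 ≤ x 0} 0 (Pi.single 1 1 : Site 3)} ≤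
        (bondPercolation (zdGraph 3) (criticalProbI 3)).real
            {ω | s((0 : Site 3), (0 : Site 3) + Pi.single 1 1) ∈ ω ∧
              ω \ {s((0 : Site 3), (0 : Site 3) + Pi.single 1 1)} ∉
                openConnIn {z : Site 3 | (0 : Site 3) 0 ≤ z 0} 0 ((0 : Site 3) + Pi.single 1 1) ∧
              (∃ u : Site 3, u - 0 ∈ box 3 r ∧
                ω \ {s((0 : Site 3), (0 : Site 3) + Pi.single 1 1)} ∈
                  openConnIn {z : Site 3 | (0 : Site 3) 0 ≤ z 0} 0 u ∧
                ∃ v w : Site 3, ω ∈ openConnIn {z : Site 3 | (0 : Site 3) 0 + 1 ≤ z 0} u v ∧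
                  ω ∈ openConnIn {z : Site 3 | (0 : Site 3) 0 + 1 ≤ z 0} u w ∧
                  ∃ i : Fin 3, (h : ℤ) ≤ |v i - w i|) ∧
              (∃ u : Site 3, u - ((0 : Site 3) + Pi.single 1 1) ∈ box 3 r ∧
                ω \ {s((0 : Site 3), (0 : Site 3) + Pi.single 1 1)} ∈
                  openConnIn {z : Site 3 | (0 : Site 3) 0 ≤ z 0} ((0 : Site 3) + Pi.single 1 1) u ∧
                ∃ v w : Site 3, ω ∈ openConnIn {z : Site 3 | (0 : Site 3) 0 + 1 ≤ z 0} u v ∧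
                  ω ∈ openConnIn {z : Site 3 | (0 : Site 3) 0 + 1 ≤ z 0} u w ∧
                  ∃ i : Fin 3, (h : ℤ) ≤ |v i - w i|)} +
        (bondPercolation (zdGraph 3) (criticalProbI 3)).real
            {ω | ∃ y : Site 3, (∃ i : Fin 3, (r : ℤ) ≤ |y i - (0 : Site 3) i|) ∧
              ω ∈ openConnIn {z : Site 3 | 0 ≤ z 0 ∧ z 0 ≤ h} 0 y} +
        (bondPercolation (zdGraph 3) (criticalProbI 3)).real
            {ω | ∃ y : Site 3, (∃ i : Fin 3, (r : ℤ) ≤ |y i - (Pi.single 1 1 : Site 3) i|) ∧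
              ω ∈ openConnIn {z : Site 3 | 0 ≤ z 0 ∧ z 0 ≤ h} (Pi.single 1 1 : Site 3) y} := by
  intro r h hr
  -- sub-additivity: it suffices to bound by the measure of the union of the three events
  refine le_trans ?_
    (le_trans (measureReal_union_le _ _) (add_le_add (measureReal_union_le _ _) le_rfl))
  -- the bridge step, then the pathwise inclusion on configurations using lattice edges
  refine le_trans (mul_real_E_le r) (real_mono_of_forall_subset_edgeSet (zdGraph 3) _ ?_)
  rintro ω hω ⟨hf, hE⟩
  rcases mem_cover (h := h) hr Set.sdiff_subset (Set.sdiff_subset.trans hω) hE with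
    hthin | hthin | hflat
  · exact Or.inl (Or.inr hthin)
  · exact Or.inr hthin
  · exact Or.inl (Or.inl ⟨hf, hflat⟩)

end Summit.CriticalPhenomena.PercolationContinuityZ3.Theorems.BoundaryTwoArmDecay

end
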